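import Mathlib

/-!
# Coercive compression (card `pauli-freezing`, first lemma) — stub `stub_coerciveCompression`

Line `Sketch` of crux `QuarksAsStableAction.StableActionBridge` (item stmt-QuantumFields-9737).

If a complex square matrix `M` is *coercive*, `c * ‖v‖² ≤ Re ⟨v, M v⟩` for all `v` with `c > 0`, then every
principal compression `M_p = M.submatrix Subtype.val Subtype.val` (restriction to the indices satisfying a
predicate `p`) is again coercive with the same constant (extend a vector on the subtype by zero), hence
`M_p` is injective, so `det M_p` is a unit, and by Cauchy–Schwarz `c * ‖w‖₂ ≤ ‖M_p w‖₂`.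
Finite-dimensional linear algebra over Mathlib only. [folklore]
-/

namespace Summit.QuantumFields.QCD.Cruxes.StableActionBridge.Sketch

/-- A sum over `n` of a function vanishing off `p` equals the corresponding sum over the subtype
`{i // p i}`. [folklore] -/
private theorem sum_eq_sum_subtype_of_vanish {n : Type*} [Fintype n] (p : n → Prop) [DecidablePred p]
    {β : Type*} [AddCommMonoid β] (f : n → β) (g : {i // p i} → β)
    (hp : ∀ j : {i // p i}, f j.val = g j) (hnp : ∀ i, ¬p i → f i = 0) :
    ∑ i, f i = ∑ j : {i // p i}, g j := by
  rw [← Fintype.sum_subtype_add_sum_subtype p f]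
  have e2 : ∑ k : {x // ¬p x}, f k = 0 := Finset.sum_eq_zero fun k _ => hnp k k.2
  rw [e2, add_zero]
  exact Fintype.sum_congr _ _ hp

/-- Cauchy–Schwarz in coordinates: `Re ∑ conj (w i) * z i ≤ ‖w‖₂ * ‖z‖₂`. [folklore] -/
private theorem re_sum_star_mul_le {ι : Type*} [Fintype ι] (w z : ι → ℂ) :
    (∑ i, star (w i) * z i).re ≤ Real.sqrt (∑ i, ‖w i‖ ^ 2) * Real.sqrt (∑ i, ‖z i‖ ^ 2) := by
  have h := norm_inner_le_norm (𝕜 := ℂ) (WithLp.toLp 2 w : EuclideanSpace ℂ ι)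
    (WithLp.toLp 2 z : EuclideanSpace ℂ ι)
  rw [EuclideanSpace.inner_toLp_toLp, EuclideanSpace.norm_eq, EuclideanSpace.norm_eq] at h
  have e : z ⬝ᵥ star w = ∑ i, star (w i) * z i := by
    simp only [dotProduct, Pi.star_apply, mul_comm]
  rw [e] at h
  exact (Complex.re_le_norm _).trans h

/-- **Coercive compression** (card pauli-freezing, first lemma): if `Re ⟨v, M v⟩ ≥ c ‖v‖²` with `c > 0`,
then every principal compression `M_p` of `M` is invertible and `c ‖w‖ ≤ ‖M_p w‖`. [folklore] -/
theorem stub_coerciveCompression :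
    ∀ (n : Type) [Fintype n] [DecidableEq n] (M : Matrix n n ℂ) (c : ℝ), 0 < c →
      (∀ v : n → ℂ, c * ∑ i, ‖v i‖ ^ 2 ≤ (∑ i, star (v i) * (M.mulVec v) i).re) →
      ∀ (p : n → Prop) [DecidablePred p],
        IsUnit (M.submatrix (Subtype.val : {i // p i} → n) Subtype.val).det ∧
        ∀ w : {i // p i} → ℂ, c * Real.sqrt (∑ i, ‖w i‖ ^ 2) ≤
          Real.sqrt (∑ i, ‖((M.submatrix (Subtype.val : {i // p i} → n) Subtype.val).mulVec w) i‖ ^ 2) := by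
  intro n _ _ M c hc hM p _
  set Mp := M.submatrix (Subtype.val : {i // p i} → n) Subtype.val with hMp
  -- Step 1: coercivity passes to the compression (extend by zero).
  have hcoer : ∀ w : {i // p i} → ℂ,
      c * ∑ i, ‖w i‖ ^ 2 ≤ (∑ i, star (w i) * (Mp.mulVec w) i).re := by
    intro w
    let v : n → ℂ := fun i => if h : p i then w ⟨i, h⟩ else 0
    have hv_p : ∀ j : {i // p i}, v j.val = w j := fun j => by simp [v, j.2]
    have hv_np : ∀ i, ¬p i → v i = 0 := fun i hi => by simp [v, hi]
    have h1 : ∑ i, ‖v i‖ ^ 2 = ∑ j : {i // p i}, ‖w j‖ ^ 2 :=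
      sum_eq_sum_subtype_of_vanish p (fun i => ‖v i‖ ^ 2) (fun j => ‖w j‖ ^ 2)
        (fun j => by simp only [hv_p]) (fun i hi => by simp [hv_np i hi])
    have h2 : ∀ j : {i // p i}, (M.mulVec v) j.val = (Mp.mulVec w) j := by
      intro j
      change ∑ i, M j.val i * v i = ∑ k : {i // p i}, M j.val k.val * w k
      exact sum_eq_sum_subtype_of_vanish p (fun i => M j.val i * v i) (fun k => M j.val k.val * w k)
        (fun k => by rw [hv_p]) (fun i hi => by rw [hv_np i hi, mul_zero])
    have h3 : ∑ i, star (v i) * (M.mulVec v) i = ∑ j : {i // p i}, star (w j) * (Mp.mulVec w) j :=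
      sum_eq_sum_subtype_of_vanish p (fun i => star (v i) * (M.mulVec v) i)
        (fun j => star (w j) * (Mp.mulVec w) j)
        (fun j => by rw [hv_p, h2]) (fun i hi => by rw [hv_np i hi, star_zero, zero_mul])
    have h4 := hM v
    rw [h1, h3] at h4
    exact h4
  -- Step 2: the norm bound, by Cauchy–Schwarz.
  have hbound : ∀ w : {i // p i} → ℂ,
      c * Real.sqrt (∑ i, ‖w i‖ ^ 2) ≤ Real.sqrt (∑ i, ‖(Mp.mulVec w) i‖ ^ 2) := by
    intro w
    set a := Real.sqrt (∑ i, ‖w i‖ ^ 2) with ha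
    set b := Real.sqrt (∑ i, ‖(Mp.mulVec w) i‖ ^ 2) with hb
    have ha0 : 0 ≤ a := Real.sqrt_nonneg _
    have hb0 : 0 ≤ b := Real.sqrt_nonneg _
    have hsum0 : 0 ≤ ∑ i, ‖w i‖ ^ 2 := Finset.sum_nonneg fun i _ => by positivity
    have key : c * a ^ 2 ≤ a * b := by
      rw [ha, Real.sq_sqrt hsum0]
      exact (hcoer w).trans (re_sum_star_mul_le w (Mp.mulVec w))
    rcases eq_or_lt_of_le ha0 with h0 | hpos
    · rw [← h0, mul_zero]
      exact hb0
    · have key' : (c * a) * a ≤ b * a := by nlinarith [key]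
      exact le_of_mul_le_mul_right key' hpos
  refine ⟨?_, hbound⟩
  -- Step 3: `det M_p` is a unit, since `M_p.mulVec` is injective.
  rw [← Matrix.isUnit_iff_isUnit_det, ← Matrix.mulVec_injective_iff_isUnit]
  intro w₁ w₂ h
  rw [← sub_eq_zero]
  set u := w₁ - w₂ with hu
  have h0 : Mp.mulVec u = 0 := by rw [hu, Matrix.mulVec_sub, h, sub_self]
  have h1 := hcoer u
  rw [h0] at h1
  simp only [Pi.zero_apply, mul_zero, Finset.sum_const_zero, Complex.zero_re] at h1
  have h2 : ∑ i, ‖u i‖ ^ 2 ≤ 0 := le_of_mul_le_mul_left (by simpa using h1) hc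
  have h3 := (Finset.sum_eq_zero_iff_of_nonneg fun i _ => by positivity).1
    (le_antisymm h2 (Finset.sum_nonneg fun i _ => by positivity))
  funext i
  have h4 := h3 i (Finset.mem_univ i)
  simpa using h4

end Summit.QuantumFields.QCD.Cruxes.StableActionBridge.Sketch
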